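import Summits.ABC.IUTFork.Cor312SettingMSharp
import Summits.ABC.IUTFork.Cor312PilotIdelesMRead
import Summits.ABC.IUTFork.Cor312PilotKummerCompat
import Summits.ABC.IUTFork.Cor312ProvenanceGenuine
import Summits.ABC.IUTFork.Thm311Real3
import Summits.ABC.ABC.Theorems.IUTThetaPilotThetaPartIIULineCapstone
import HarnessLib

/-!
# Branch C certificate v7 (G1-Θ unit P7, C-R12 (e) target #2′): the HULL-LEVEL line AT THE M-LEVEL GENUINE REAL SETTING —
# carriers `K_{v̲}`, `v̲ ∈ V̲` (the completions in which abc-iut-S2's genuine ideles `I.tΘ`, `I.tq` LIVE), pilot regions READ OFF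
# THOSE IDELES; the five side conditions of v5 are THEOREMS here (no `ht*`/`htq*` binder); q-number and `BridgeHyps` NAMED

C scoreboard, v7 companion (apex `abc_of_SH_v7M` in `Conditional/AbcOfSGenuineMApex.lean`; this file = the per-datum theorem): per datum S_H 1 · PIN 1 · BRIDGE 1 · PROV 1 · READ 1 (`hΘ` one-sided) · SIDE 0 · FACT 0 = 5
(explicit), plus the (P,l)-level CONE binder `hreg` = 6; EFFECTIVE: tool line on STATUS. Reference: v5 `abc_of_SH_v5K` (p434856, §K line of
record): S_H 1 · PIN 1 · READ 1 · SIDE 5 + CONE 1 = 9, with `BridgeHyps` and the q-number DISCHARGED over the completions `K_w` at ALL places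
`w` of `K` (abc-iut-c312-7 p424856, `Cor312ProvK`). HERE the index set is abc-iut-c312-5's M-skeleton `Real.thetaIndexOfInitial T.D` (places
`V̲ ≅ V_mod` ONLY, [IUTchI] Def. 3.1 (e)) — the indexing of abc-iut-S2's `T.negLogTheta` — so the READ binder `hΘ` compares two numbers over
the SAME carriers (abc-iut-w5-d054 09:59:47Z: no cross-field and no cross-index seam left; G1-Θ unit P6 targets exactly this `hΘ`), and the
two NAMED binders are the two remaining G1-Θ deliverables AS TYPED: [BRIDGE] `Cor312Vol.BridgeHyps` of the M-setting (unit P5: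
`thetaFinite`/`hullDefined` from the boxes — abc-iut-s2-p9 `Cor312ThetaFiniteM`), [PROV] abc-iut-c312-8's provenance link
`Cor312Prov.IsSettingOf T.D P` (its one quantitative field `negLogQ_eq : P.negLogQ = −absLogq T.D`; unit P5 `negLogQ_…M` / c312-8
`isSettingOf_ofFrames` modulo (hmarg)/(hbad)/(hgood)). When P5/P6 land, the companion `Shrink` instantiates [BRIDGE], [PROV], [READ] BY NAME and
the certificate reads S_H 1 · PIN 1 + CONE 1.

PROOF-ONLY file (no `def`, no new `Prop`) by the INTAKE seat abc-iut-C-cert-3 (G1-Θ unit P7 of abc-iut-w5-d166's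
`HOME/staging/w5/w5-d166/g4/G1-THETA-SHAPES.md` §5: «C-cert-3 Shrink twin at the M setting (hΘ, hq discharged; ht*/htq* gone)»).
THE SETTING per datum `T : Cor22.ThetaVolumeDatumAt P l` (NO pilot-data / provenance-data / field / idele binder): abc-iut-w5-d166's
`Real.settingMSharp T.D hlog …` (`Cor312SettingMSharp`, p435453 ✓; = abc-iut-c312-6's `settingOfFrameVolumes` over the M-level field-box
pieces `frameVolumePiecesOfInitialDH`, p434705 ✓) at the FIXED analytic logarithms `Real.analyticLogvVal T.K`
(`logvAnalyticVal_analyticLogvVal`), with Θ-ideles `t u i x := Real.tThetaM T.D p_u u _ (ideleDataOf T.D T.isVolumeInputOf) i x` and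
q-ideles `tq u x := Real.tqM …` READ OFF the datum's own volume input `T.I` (abc-iut-w5-d033 `Cor312PilotIdelesMRead`, p436273 ✓:
`T.I = volumeInputOf T.D (ideleDataOf …)`), `htq0 := tqM_ne_zero`, `Sq :=` the finite set of rational places under a member of `V̲` lying
in `S = V^bad_mod` (`GenuineM.finite_ratPlaces_under_S`), `htq1 := norm_tqM_eq_one_of_not_mem` — so v5's [SIDE] group `htq0 htq1 ht0 ht1 htq`
has NO binder here: each is a theorem of `Cor312PilotIdelesMRead` (`tThetaM_ne_zero`, `norm_tThetaM_eq_one_of_not_mem`, `log_norm_tqM`, …).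
FREE per datum (as in v5): the context binders `M archPk archSub Ψ act Mmod region`, the column data `frob* unitImage ballImage thetaDiv`,
`n lat sig split qData`, PR-1's `ρ`, `qK`.

HONEST FRAMING: this campaign LOCATES / CONDITIONALLY VERIFIES. Nothing here asserts that abc is proved or refuted, or that [IUTchIII]
Cor. 3.12 / Thm. 3.11 holds or fails, or takes a side on any author (Mochizuki / Scholze–Stix / Joshi / Dupuy–Hilado); «`ABC` follows from
S_H + the listed hypotheses AS TYPED, at these data», nothing more; S_H is an assumption label; typed ≠ proved; instantiated ≠ endorsed.
[claim: Mochizuki2012, status: disputed] [cite: Mochizuki2012, IUTchI Def. 3.1 (e) p. 62; IUTchIII Cor. 3.12 p. 173–174, Step (xi-d) p. 183;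
IUTchIV Thm. 1.10 p. 23] [cite: DupuyHilado2025, §3.4, §3.9, §4.10]
-/

noncomputable section

open Set Function NumberField IsDedekindDomain

namespace Summit.ABC.IUTFork.Conditional

open Thm311 Thm311.Real Cor312 Cor312Vol Cor312Prov Literature.IUT.LogThetaLattice Literature.IUT.LogVolume
  Literature.IUT.HodgeTheaters Literature.IUT.LogVolume.ThetaData Literature.NumberTheory.NumberFields

/-! ## §0. The finite set of rational places under the bad places met by `V̲` -/

section PerDatum

variable {F K Fbar : Type} [Field F] [NumberField F] [Field K] [NumberField K] [Algebra F K] [Field Fbar]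
  [Algebra F Fbar] [Algebra K Fbar] {E : WeierstrassCurve F} [E.IsElliptic] {l : ℕ} {Pb : BadPlacePredicates K}

/-- The rational places `u` under a member `x ∈ V̲_u` whose place of `F_mod` lies in `S = V^bad_mod` form a FINITE set (they lie under
the finite set `S`: the place of `ℚ` under `v(x)` is `u`, abc-iut-w5-d033 `under_rat_eq_maximalIdeal`). Its `toFinset` is the `Sq` at
which the M-setting's `q`-support finiteness is read. [folklore] -/
theorem GenuineM.finite_ratPlaces_under_S (D : InitialThetaData F K Fbar E l Pb) :
    {u : FinitePlace ℚ | ∃ x : (thetaIndexOfInitial D).Fibre (Val.non u),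
      placeModOfM D u x ∈ (ThetaData.pilotData D).S}.Finite := by
  refine (((ThetaData.pilotData D).S.finite_toSet.image fun v : HeightOneSpectrum (𝓞 (fieldOfModuli E)) =>
    FinitePlace.mk (v.under (𝓞 ℚ)))).subset ?_
  rintro u ⟨x, hx⟩
  refine ⟨placeModOfM D u x, hx, ?_⟩
  show FinitePlace.mk ((placeOverOfFibreM D (ratChar u) u (natCast_ratChar_mem u) x).1.under (𝓞 ℚ)) = u
  rw [under_rat_eq_maximalIdeal (ratChar u) u (natCast_ratChar_mem u), FinitePlace.mk_maximalIdeal]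

variable (D : InitialThetaData F K Fbar E l Pb) {I : ThetaVolumeInput (fieldOfModuli E) K}
  (M : Type) [Field M] [NumberField M]
  (archPk : ∀ (j : (thetaIndexOfInitial D).Label) (vQ : (thetaIndexOfInitial D).VQ),
    Set ((logShellsOfInitialDH D (analyticLogvVal K)).Packet j vQ))
  (archSub : ∀ (j : (thetaIndexOfInitial D).Label) (v : (thetaIndexOfInitial D).V),
    Set ((logShellsOfInitialDH D (analyticLogvVal K)).Packet j ((thetaIndexOfInitial D).over v)))
  (Ψ : ℤ → ∀ v : (thetaIndexOfInitial D).V, v ∈ (thetaIndexOfInitial D).Vbad →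
    Set ((logShellsOfInitialDH D (analyticLogvVal K)).StarPacket v))
  (act : ℤ → ∀ v : (thetaIndexOfInitial D).V, v ∈ (thetaIndexOfInitial D).Vbad →
    (logShellsOfInitialDH D (analyticLogvVal K)).StarPacket v →
      Module.End ℚ ((logShellsOfInitialDH D (analyticLogvVal K)).StarPacket v))
  (Mmod : ℤ → ∀ j : (thetaIndexOfInitial D).LabelStar, Set ((logShellsOfInitialDH D (analyticLogvVal K)).GlobalPacket j.1))
  (region : ℤ → ∀ j : (thetaIndexOfInitial D).LabelStar, FinDivisor M → ∀ vQ : (thetaIndexOfInitial D).VQ,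
    Set ((logShellsOfInitialDH D (analyticLogvVal K)).Packet j.1 vQ))
  (frobAdm : ℤ → ℤ → ∀ (j : (thetaIndexOfInitial D).Label) (vQ : (thetaIndexOfInitial D).VQ),
    Set ((logShellsOfInitialDH D (analyticLogvVal K)).Packet j vQ) → Prop)
  (frobLogvol : ℤ → ℤ → ∀ (j : (thetaIndexOfInitial D).Label) (vQ : (thetaIndexOfInitial D).VQ),
    Set ((logShellsOfInitialDH D (analyticLogvVal K)).Packet j vQ) → ℝ)
  (frobΨ : ℤ → ℤ → ∀ v : (thetaIndexOfInitial D).V, v ∈ (thetaIndexOfInitial D).Vbad →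
    Set ((logShellsOfInitialDH D (analyticLogvVal K)).StarPacket v))
  (frobMmod : ℤ → ℤ → ∀ j : (thetaIndexOfInitial D).LabelStar, Set ((logShellsOfInitialDH D (analyticLogvVal K)).GlobalPacket j.1))
  (unitImage : ℤ → ℤ → ℕ → ∀ (j : (thetaIndexOfInitial D).Label) (vQ : (thetaIndexOfInitial D).VQ),
    Set ((logShellsOfInitialDH D (analyticLogvVal K)).Packet j vQ))
  (ballImage : ℤ → ℤ → ∀ (j : (thetaIndexOfInitial D).Label) (vQ : (thetaIndexOfInitial D).VQ),
    Set ((logShellsOfInitialDH D (analyticLogvVal K)).Packet j vQ))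
  (thetaDiv : ℤ → ℤ → LgpDivisor M (thetaIndexOfInitial D).lstar)
  (n : ℤ) {HT : Type} {LogLink : HT → HT → Type} {IsFull : ∀ {s t : HT}, LogLink s t → Prop}
  (lat : LGPGaussianLogThetaLattice LogLink IsFull)
  {Frd : Type} {IsoF : Frd → Frd → Type} {Ob : Frd → Type} {realify : Frd → Frd} {Strip : Type}
  {IsoS : Strip → Strip → Type} {Mv : ∀ v : (thetaIndexOfInitial D).V, v ∈ (thetaIndexOfInitial D).Vbad → Type}
  [∀ v h, Monoid (Mv v h)]
  (sig : GlobalLGPFrobenioidSignature (thetaIndexOfInitial D).lstar (thetaIndexOfInitial D).V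
    (· ∈ (thetaIndexOfInitial D).Vbad) Frd IsoF Ob realify Strip IsoS Mv)
  (split : SplittingMonoids Mv) {ObΔ : Type} {N : ∀ v : (thetaIndexOfInitial D).V, v ∈ (thetaIndexOfInitial D).Vbad → Type}
  [∀ v h, Monoid (N v h)] (qData : QPilotData ObΔ N)
  (ρ : (∀ v : (thetaIndexOfInitial D).V, v ∈ (thetaIndexOfInitial D).Vbad →
      Set ((logShellsOfInitialDH D (analyticLogvVal K)).StarPacket v)) →
    ∀ (j : (thetaIndexOfInitial D).Label) (vQ : (thetaIndexOfInitial D).VQ),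
      Set ((logShellsOfInitialDH D (analyticLogvVal K)).Packet j vQ))
  (qK : ∀ v : (thetaIndexOfInitial D).V, v ∈ (thetaIndexOfInitial D).Vbad →
    Set ((logShellsOfInitialDH D (analyticLogvVal K)).StarPacket v))

/-! ## §1. One datum, GENERIC ideles in `K_{v̲}`: `I.Cor312Of` from S_H + q-pin + `BridgeHyps` + provenance + the one-sided Θ-side identification -/

/-- **One datum at abc-iut-w5-d166's M-level sharp setting `settingMSharp` over generic Θ- and q-idele binders in the genuine completions
`K_{v̲}`**: `I.Cor312Of` from [BRIDGE] `BridgeHyps`, [PIN] the q-pin, [S_H] the hull-level printed clause, [PROV] abc-iut-c312-8's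
`IsSettingOf T.D P` (q-number) and [READ] the one-sided Θ-side identification. Proof: `statement_of_pilotKummerCompatHull` gives the printed
`Statement`; its inequality `−|log(q)| ≤ −|log(Θ)|` is read through `IsSettingOf.negLogQ_eq` and `negAbsLogQ_eq_neg_absLogq_of_isVolumeInputOf`
(the two q-sides are ONE number) and `hΘ`. «`I.Cor312Of` follows from these hypotheses as typed» — no side taken. [claim: Mochizuki2012, status: disputed] -/
theorem GenuineM.cor312Of_of_SH_ideles (hI : ThetaData.IsVolumeInputOf D I)
    (t : ∀ (u : FinitePlace ℚ) (_ : Fin (thetaIndexOfInitial D).lstar) (x : (thetaIndexOfInitial D).Fibre (Val.non u)),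
      kOfM D (ratChar u) u (natCast_ratChar_mem u) x)
    (tq : ∀ (u : FinitePlace ℚ) (x : (thetaIndexOfInitial D).Fibre (Val.non u)), kOfM D (ratChar u) u (natCast_ratChar_mem u) x)
    (htq0 : ∀ u x, tq u x ≠ 0) (Sq : Finset (FinitePlace ℚ))
    (htq1 : ∀ (u : FinitePlace ℚ) (x : (thetaIndexOfInitial D).Fibre (Val.non u)), u ∉ Sq → ‖tq u x‖ = 1)
    (hBridge : Cor312Vol.BridgeHyps
      (settingMSharp D (logvAnalyticVal_analyticLogvVal (K := K)) M archPk archSub Ψ act Mmod region n lat sig split qData t tq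
        htq0 Sq htq1))
    (hSH : Cor312Vol.PilotKummerCompatHull
      (LatticeSituation.ofShells (logShellsOfInitialDH D (analyticLogvVal K)) M archPk archSub
        (frameVolumePiecesOfInitialDH D (logvAnalyticVal_analyticLogvVal (K := K))).Adm
        (frameVolumePiecesOfInitialDH D (logvAnalyticVal_analyticLogvVal (K := K))).logvol Ψ act Mmod region frobAdm frobLogvol
        frobΨ frobMmod unitImage ballImage thetaDiv)
      (settingMSharp D (logvAnalyticVal_analyticLogvVal (K := K)) M archPk archSub Ψ act Mmod region n lat sig split qData t tq
        htq0 Sq htq1) ρ qK)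
    (hQPin : Cor312Vol.QPinned
      (LatticeSituation.ofShells (logShellsOfInitialDH D (analyticLogvVal K)) M archPk archSub
        (frameVolumePiecesOfInitialDH D (logvAnalyticVal_analyticLogvVal (K := K))).Adm
        (frameVolumePiecesOfInitialDH D (logvAnalyticVal_analyticLogvVal (K := K))).logvol Ψ act Mmod region frobAdm frobLogvol
        frobΨ frobMmod unitImage ballImage thetaDiv)
      (settingMSharp D (logvAnalyticVal_analyticLogvVal (K := K)) M archPk archSub Ψ act Mmod region n lat sig split qData t tq
        htq0 Sq htq1) ρ qK)
    (hprov : Cor312Prov.IsSettingOf D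
      (settingMSharp D (logvAnalyticVal_analyticLogvVal (K := K)) M archPk archSub Ψ act Mmod region n lat sig split qData t tq
        htq0 Sq htq1))
    (hΘ : (settingMSharp D (logvAnalyticVal_analyticLogvVal (K := K)) M archPk archSub Ψ act Mmod region n lat sig split qData t tq
        htq0 Sq htq1).negLogTheta ≤ ((I.negLogTheta : ℝ) : WithTop ℝ)) :
    I.Cor312Of := by
  -- Step 1: the verbatim Statement at the M-level sharp setting, hull-level line (no Thm 3.11 input)
  have hst : (settingMSharp D (logvAnalyticVal_analyticLogvVal (K := K)) M archPk archSub Ψ act Mmod region n lat sig split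
      qData t tq htq0 Sq htq1).Statement := Cor312Vol.statement_of_pilotKummerCompatHull
    (LatticeSituation.ofShells (logShellsOfInitialDH D (analyticLogvVal K)) M archPk archSub
      (frameVolumePiecesOfInitialDH D (logvAnalyticVal_analyticLogvVal (K := K))).Adm
      (frameVolumePiecesOfInitialDH D (logvAnalyticVal_analyticLogvVal (K := K))).logvol Ψ act Mmod region frobAdm frobLogvol
      frobΨ frobMmod unitImage ballImage thetaDiv)
    (settingMSharp D (logvAnalyticVal_analyticLogvVal (K := K)) M archPk archSub Ψ act Mmod region n lat sig split qData t tq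
      htq0 Sq htq1) ρ qK hBridge hQPin hSH
  obtain ⟨-, hle⟩ := hst
  -- Step 2: the q-side — `−|log(q)|` of the setting `= −absLogq D = I.negAbsLogQ` (provenance, both sides)
  rw [hprov.negLogQ_eq] at hle
  show I.negAbsLogQ ≤ I.negLogTheta
  rw [Cor312Prov.negAbsLogQ_eq_neg_absLogq_of_isVolumeInputOf D hI]
  -- Step 3: the Θ-side by the one-sided identification `hΘ`
  exact WithTop.coe_le_coe.mp (hle.trans hΘ)

/-! ## §2. One datum, the ideles READ OFF the volume input `I`: no side-condition binder -/

/-- **One datum at the M-level sharp setting WITH THE PILOT REGIONS READ OFF THE GENUINE IDELES OF `I`** (`tThetaM`/`tqM` of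
`ideleDataOf T.D hI`; `htq0`, `htq1` DISCHARGED by `tqM_ne_zero`, `norm_tqM_eq_one_of_not_mem`; `Sq :=` §0): `I.Cor312Of` from
[BRIDGE] + [S_H] + [PIN] + [PROV] + [READ] — explicit S_H 1 · PIN 1 · BRIDGE 1 · PROV 1 · READ 1 · SIDE 0. «`I.Cor312Of` follows from these
hypotheses as typed, at these data» — no side taken. [claim: Mochizuki2012, status: disputed] -/
theorem GenuineM.cor312Of_of_SH (hI : ThetaData.IsVolumeInputOf D I)
    (hBridge : Cor312Vol.BridgeHyps
      (settingMSharp D (logvAnalyticVal_analyticLogvVal (K := K)) M archPk archSub Ψ act Mmod region n lat sig split qData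
        (fun u i x => tThetaM D (ratChar u) u (natCast_ratChar_mem u) (ideleDataOf D hI) i x)
        (fun u x => tqM D (ratChar u) u (natCast_ratChar_mem u) (ideleDataOf D hI) x)
        (fun u x => tqM_ne_zero D (ratChar u) u (natCast_ratChar_mem u) (ideleDataOf D hI) x)
        (GenuineM.finite_ratPlaces_under_S D).toFinset
        (fun u x hu => norm_tqM_eq_one_of_not_mem D (ratChar u) u (natCast_ratChar_mem u) (ideleDataOf D hI) x
          fun hx => hu ((Set.Finite.mem_toFinset _).mpr ⟨x, hx⟩))))
    (hSH : Cor312Vol.PilotKummerCompatHull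
      (LatticeSituation.ofShells (logShellsOfInitialDH D (analyticLogvVal K)) M archPk archSub
        (frameVolumePiecesOfInitialDH D (logvAnalyticVal_analyticLogvVal (K := K))).Adm
        (frameVolumePiecesOfInitialDH D (logvAnalyticVal_analyticLogvVal (K := K))).logvol Ψ act Mmod region frobAdm frobLogvol
        frobΨ frobMmod unitImage ballImage thetaDiv)
      (settingMSharp D (logvAnalyticVal_analyticLogvVal (K := K)) M archPk archSub Ψ act Mmod region n lat sig split qData
        (fun u i x => tThetaM D (ratChar u) u (natCast_ratChar_mem u) (ideleDataOf D hI) i x)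
        (fun u x => tqM D (ratChar u) u (natCast_ratChar_mem u) (ideleDataOf D hI) x)
        (fun u x => tqM_ne_zero D (ratChar u) u (natCast_ratChar_mem u) (ideleDataOf D hI) x)
        (GenuineM.finite_ratPlaces_under_S D).toFinset
        (fun u x hu => norm_tqM_eq_one_of_not_mem D (ratChar u) u (natCast_ratChar_mem u) (ideleDataOf D hI) x
          fun hx => hu ((Set.Finite.mem_toFinset _).mpr ⟨x, hx⟩))) ρ qK)
    (hQPin : Cor312Vol.QPinned
      (LatticeSituation.ofShells (logShellsOfInitialDH D (analyticLogvVal K)) M archPk archSub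
        (frameVolumePiecesOfInitialDH D (logvAnalyticVal_analyticLogvVal (K := K))).Adm
        (frameVolumePiecesOfInitialDH D (logvAnalyticVal_analyticLogvVal (K := K))).logvol Ψ act Mmod region frobAdm frobLogvol
        frobΨ frobMmod unitImage ballImage thetaDiv)
      (settingMSharp D (logvAnalyticVal_analyticLogvVal (K := K)) M archPk archSub Ψ act Mmod region n lat sig split qData
        (fun u i x => tThetaM D (ratChar u) u (natCast_ratChar_mem u) (ideleDataOf D hI) i x)
        (fun u x => tqM D (ratChar u) u (natCast_ratChar_mem u) (ideleDataOf D hI) x)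
        (fun u x => tqM_ne_zero D (ratChar u) u (natCast_ratChar_mem u) (ideleDataOf D hI) x)
        (GenuineM.finite_ratPlaces_under_S D).toFinset
        (fun u x hu => norm_tqM_eq_one_of_not_mem D (ratChar u) u (natCast_ratChar_mem u) (ideleDataOf D hI) x
          fun hx => hu ((Set.Finite.mem_toFinset _).mpr ⟨x, hx⟩))) ρ qK)
    (hprov : Cor312Prov.IsSettingOf D
      (settingMSharp D (logvAnalyticVal_analyticLogvVal (K := K)) M archPk archSub Ψ act Mmod region n lat sig split qData
        (fun u i x => tThetaM D (ratChar u) u (natCast_ratChar_mem u) (ideleDataOf D hI) i x)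
        (fun u x => tqM D (ratChar u) u (natCast_ratChar_mem u) (ideleDataOf D hI) x)
        (fun u x => tqM_ne_zero D (ratChar u) u (natCast_ratChar_mem u) (ideleDataOf D hI) x)
        (GenuineM.finite_ratPlaces_under_S D).toFinset
        (fun u x hu => norm_tqM_eq_one_of_not_mem D (ratChar u) u (natCast_ratChar_mem u) (ideleDataOf D hI) x
          fun hx => hu ((Set.Finite.mem_toFinset _).mpr ⟨x, hx⟩))))
    (hΘ : (settingMSharp D (logvAnalyticVal_analyticLogvVal (K := K)) M archPk archSub Ψ act Mmod region n lat sig split qData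
        (fun u i x => tThetaM D (ratChar u) u (natCast_ratChar_mem u) (ideleDataOf D hI) i x)
        (fun u x => tqM D (ratChar u) u (natCast_ratChar_mem u) (ideleDataOf D hI) x)
        (fun u x => tqM_ne_zero D (ratChar u) u (natCast_ratChar_mem u) (ideleDataOf D hI) x)
        (GenuineM.finite_ratPlaces_under_S D).toFinset
        (fun u x hu => norm_tqM_eq_one_of_not_mem D (ratChar u) u (natCast_ratChar_mem u) (ideleDataOf D hI) x
          fun hx => hu ((Set.Finite.mem_toFinset _).mpr ⟨x, hx⟩))).negLogTheta ≤
      ((I.negLogTheta : ℝ) : WithTop ℝ)) :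
    I.Cor312Of :=
  GenuineM.cor312Of_of_SH_ideles D M archPk archSub Ψ act Mmod region frobAdm frobLogvol frobΨ frobMmod unitImage ballImage thetaDiv n
    lat sig split qData ρ qK hI _ _ _ _ _ hBridge hSH hQPin hprov hΘ

/-- **The v5 side conditions HOLD at the read-off ideles** (census: SIDE 0 is not a hidden binder): `ht0`, `htq0` (non-zero), `ht1`, `htq1`
(units off `S`) and `htq`, `ht` (Dupuy–Hilado (3.4): `log ‖t_q‖ = −P_q·log N/n`, `log ‖t_Θ‖ = −P_Θ·log N/n`) are THEOREMS of abc-iut-w5-d033's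
`Cor312PilotIdelesMRead` at `tThetaM`/`tqM` — restated here at `p := p_u` as one conjunction, for the record. [cite: DupuyHilado2025, §3.4, §3.9] -/
theorem GenuineM.sideConditions_hold (hI : ThetaData.IsVolumeInputOf D I) :
    (∀ (u : FinitePlace ℚ) (i : Fin (thetaIndexOfInitial D).lstar) (x : (thetaIndexOfInitial D).Fibre (Val.non u)),
        tThetaM D (ratChar u) u (natCast_ratChar_mem u) (ideleDataOf D hI) i x ≠ 0) ∧
      (∀ (u : FinitePlace ℚ) (x : (thetaIndexOfInitial D).Fibre (Val.non u)),
        tqM D (ratChar u) u (natCast_ratChar_mem u) (ideleDataOf D hI) x ≠ 0) ∧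
      (∀ (u : FinitePlace ℚ) (i : Fin (thetaIndexOfInitial D).lstar) (x : (thetaIndexOfInitial D).Fibre (Val.non u)),
        placeModOfM D u x ∉ (ThetaData.pilotData D).S → ‖tThetaM D (ratChar u) u (natCast_ratChar_mem u) (ideleDataOf D hI) i x‖ = 1) ∧
      (∀ (u : FinitePlace ℚ) (x : (thetaIndexOfInitial D).Fibre (Val.non u)),
        placeModOfM D u x ∉ (ThetaData.pilotData D).S → ‖tqM D (ratChar u) u (natCast_ratChar_mem u) (ideleDataOf D hI) x‖ = 1) ∧
      (∀ (u : FinitePlace ℚ) (x : (thetaIndexOfInitial D).Fibre (Val.non u)),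
        Real.log ‖tqM D (ratChar u) u (natCast_ratChar_mem u) (ideleDataOf D hI) x‖ =
          -((ThetaData.pilotData D).qPilot (placeModOfM D u x)) * logNorm (fieldOfModuli E) (placeModOfM D u x) /
            localDegree (fieldOfModuli E) (placeModOfM D u x)) ∧
      (∀ (u : FinitePlace ℚ) (i : Fin (thetaIndexOfInitial D).lstar) (x : (thetaIndexOfInitial D).Fibre (Val.non u)),
        Real.log ‖tThetaM D (ratChar u) u (natCast_ratChar_mem u) (ideleDataOf D hI) i x‖ =
          -((ThetaData.pilotData D).thetaPilot i (placeModOfM D u x)) * logNorm (fieldOfModuli E) (placeModOfM D u x) /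
            localDegree (fieldOfModuli E) (placeModOfM D u x)) :=
  ⟨fun u i x => tThetaM_ne_zero D (ratChar u) u (natCast_ratChar_mem u) _ i x,
    fun u x => tqM_ne_zero D (ratChar u) u (natCast_ratChar_mem u) _ x,
    fun u i x hx => norm_tThetaM_eq_one_of_not_mem D (ratChar u) u (natCast_ratChar_mem u) _ i x hx,
    fun u x hx => norm_tqM_eq_one_of_not_mem D (ratChar u) u (natCast_ratChar_mem u) _ x hx,
    fun u x => log_norm_tqM D (ratChar u) u (natCast_ratChar_mem u) _ x,
    fun u i x => log_norm_tThetaM D (ratChar u) u (natCast_ratChar_mem u) _ i x⟩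

end PerDatum

end Summit.ABC.IUTFork.Conditional
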